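import Literature.Analysis.SingularIntegrals.HardyLittlewoodSobolevWeak
import HarnessLib

/-!
# Weak-type Hardy–Littlewood–Sobolev: weak-`L^q` membership and a.e. finiteness of Riesz potentials
# of weak-`L^p` data; the `ℝ³`, `α = 1` instances (Stein 1970, Ch. V §1.2 Theorem 1, §1.4)

Analysis/SingularIntegrals proof file (theorems only; no definition, no named fact), sibling of
`HardyLittlewoodSobolevWeak.lean`, whose distribution-function inequality
`meas_lt_rieszPotential_le_of_eWeakLpPow` (`μ{t < I_α‖f‖} ≤ C W^{n/(n−αp)} t^{−q}`,
`W = sup_s s^p μ{‖f‖ > s}`, `q = np/(n−αp)`, `1 < p`, `αp < n`) is repackaged here: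

* `eWeakLpPow_rieszPotential_toReal_le` — `sup_t t^q μ{t < I_α‖f‖} ≤ C W^{n/(n−αp)}` for the real
  function `x ↦ (I_α‖f‖(x)).toReal`, i.e. `‖I_α|f|‖_{L^{q,∞}} ≤ C^{1/q}‖f‖_{L^{p,∞}}` in the tree's
  `eWeakLpPow` vocabulary; `memWeakLp_rieszPotential_toReal` — `I_α : L^{p,∞} → L^{q,∞}`;
* `rieszPotential_lt_top_ae` — the potential of a weak-`L^p` function is finite a.e. (Stein's part (a)
  for weak-`L^p` data);
* `exists_weakHLS_one_R3`, `exists_weakHLS_one_nineFifths` — `n = 3`, `α = 1`: `1 < p < 3`,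
  `q = 3p/(3−p)`, and the endpoint Biot–Savart exponents `p = 9/5 ↦ q = 9/2` (`W^{5/2} t^{−9/2}`), the
  Lorentz–HLS step of critical steady Navier–Stokes Liouville theorems with `curl v ∈ L^{9/5,∞}(ℝ³)`
  (`|K₃(x−y)| ≤ c|x−y|⁻²`, so `|K₃ ∗ ω| ≤ c I₁|ω|`).

## References

* E. M. Stein, *Singular integrals and differentiability properties of functions*, Princeton Math.
  Series 30 (1970): Ch. V §1.2 Theorem 1 (a)–(b), §1.4 (Comment). [Stein1971]
-/

noncomputable section

open MeasureTheory Metric Set Filter Topology Real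
open scoped ENNReal NNReal

namespace Literature.Analysis.SingularIntegrals

open Literature.Analysis.FunctionSpaces

universe u

variable {E : Type u} [NormedAddCommGroup E] [NormedSpace ℝ E] [FiniteDimensional ℝ E]
  [MeasurableSpace E] [BorelSpace E] (μ : Measure E) [μ.IsAddHaarMeasure]
variable {F : Type*} [NormedAddCommGroup F]

/-! ### The potential as a real function: weak-`L^q` bound, membership, a.e. finiteness -/

/-- The superlevel sets of the real function `x ↦ (I x).toReal` sit inside those of `I`:
`{t < ‖(I x).toReal‖ₑ} ⊆ {t < I x}` (`t : ℝ≥0`; where `I x = ∞` the real function is `0`).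
[folklore] -/
private theorem setOf_lt_enorm_toReal_subset {X : Type*} (I : X → ℝ≥0∞) (t : ℝ≥0) :
    {x | (t : ℝ≥0∞) < ‖(I x).toReal‖ₑ} ⊆ {x | ENNReal.ofReal (t : ℝ) < I x} := by
  intro x hx
  rw [mem_setOf_eq] at hx ⊢
  rw [ENNReal.ofReal_coe_nnreal]
  by_cases hI : I x = ∞
  · rw [hI]; exact ENNReal.coe_lt_top
  · rwa [Real.enorm_eq_ofReal ENNReal.toReal_nonneg, ENNReal.ofReal_toReal hI] at hx

/-- **HLS, weak type, in the weak-`L^q` vocabulary of the tree**: for `1 < p`, `0 < α`, `αp < n`,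
`q = np/(n−αp)`, there is `C < ∞` with
`sup_t t^q μ{t < I_α‖f‖} ≤ C · (sup_s s^p μ{s < ‖f‖})^{n/(n−αp)}` for every a.e.-strongly
measurable `f`, the potential being read as the real function `x ↦ (I_α‖f‖(x)).toReal` (so that
`eWeakLpPow` applies; it is a.e. equal to the `[0,∞]`-valued potential by
`rieszPotential_lt_top_ae`). In norms: `‖I_α|f|‖_{L^{q,∞}} ≤ C^{1/q} ‖f‖_{L^{p,∞}}`.
[cite: Stein1971, Ch. V §1.2 Theorem 1 and §1.4 (Comment)] -/
theorem eWeakLpPow_rieszPotential_toReal_le {α : ℝ} {p : ℝ≥0∞} (hp : 1 < p.toReal) (hα : 0 < α)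
    (hαp : α * p.toReal < (Module.finrank ℝ E : ℝ)) :
    ∃ C : ℝ≥0∞, C < ∞ ∧ ∀ (f : E → F), AEStronglyMeasurable f μ →
      eWeakLpPow (fun x => (rieszPotential μ α (fun y => ‖f y‖ₑ) x).toReal)
          (ENNReal.ofReal ((Module.finrank ℝ E : ℝ) * p.toReal /
            ((Module.finrank ℝ E : ℝ) - α * p.toReal))) μ ≤
        C * eWeakLpPow f p μ ^ ((Module.finrank ℝ E : ℝ) / ((Module.finrank ℝ E : ℝ) - α * p.toReal)) := by
  set n : ℝ := (Module.finrank ℝ E : ℝ) with hn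
  set P : ℝ := p.toReal with hP
  have hP0 : 0 < P := by linarith
  have hnP : 0 < n - α * P := by linarith
  have hn0 : 0 < n := lt_trans (mul_pos hα hP0) hαp
  set q : ℝ := n * P / (n - α * P) with hq
  set a : ℝ := n / (n - α * P) with ha
  have hq0 : 0 < q := div_pos (mul_pos hn0 hP0) hnP
  obtain ⟨C, hC, H⟩ := meas_lt_rieszPotential_le_of_eWeakLpPow μ (F := F) hp hα hαp
  refine ⟨C, hC, fun f hf => ?_⟩
  set W : ℝ≥0∞ := eWeakLpPow f p μ with hW
  rw [eWeakLpPow_le_iff]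
  intro t
  have hqq : (ENNReal.ofReal q).toReal = q := ENNReal.toReal_ofReal hq0.le
  rw [hqq]
  rcases eq_or_ne t 0 with ht0 | ht0
  · rw [ht0, ENNReal.coe_zero, ENNReal.zero_rpow_of_pos hq0, zero_mul]; exact bot_le
  have htpos : (0 : ℝ) < t := NNReal.coe_pos.2 (pos_iff_ne_zero.2 ht0)
  have hone : (t : ℝ≥0∞) ^ q * ENNReal.ofReal ((t : ℝ) ^ (-q)) = 1 := by
    rw [← ENNReal.ofReal_coe_nnreal, ENNReal.ofReal_rpow_of_pos htpos,
      ← ENNReal.ofReal_mul (by positivity), ← Real.rpow_add htpos, add_neg_cancel, Real.rpow_zero,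
      ENNReal.ofReal_one]
  calc (t : ℝ≥0∞) ^ q * μ {x | (t : ℝ≥0∞) < ‖(rieszPotential μ α (fun y => ‖f y‖ₑ) x).toReal‖ₑ}
      ≤ (t : ℝ≥0∞) ^ q * μ {x | ENNReal.ofReal (t : ℝ) < rieszPotential μ α (fun y => ‖f y‖ₑ) x} :=
        mul_le_mul_right (measure_mono (setOf_lt_enorm_toReal_subset _ t)) _
    _ ≤ (t : ℝ≥0∞) ^ q * (C * W ^ a * ENNReal.ofReal ((t : ℝ) ^ (-q))) :=
        mul_le_mul_right (H f hf t htpos) _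
    _ = C * W ^ a * ((t : ℝ≥0∞) ^ q * ENNReal.ofReal ((t : ℝ) ^ (-q))) := by ring
    _ = C * W ^ a := by rw [hone, mul_one]

/-- **`I_α` maps `L^{p,∞}` into `L^{q,∞}`** (`1 < p`, `0 < α`, `αp < n`, `q = np/(n−αp)`): for
`f ∈ L^{p,∞}(μ)`, the real function `x ↦ (I_α‖f‖(x)).toReal` lies in weak-`L^q`
(`MemWeakLp · (ENNReal.ofReal q) μ`). [cite: Stein1971, Ch. V §1.2 Theorem 1 and §1.4 (Comment)] -/
theorem memWeakLp_rieszPotential_toReal {α : ℝ} {p : ℝ≥0∞} (hp : 1 < p.toReal) (hα : 0 < α)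
    (hαp : α * p.toReal < (Module.finrank ℝ E : ℝ)) {f : E → F} (hf : MemWeakLp f p μ) :
    MemWeakLp (fun x => (rieszPotential μ α (fun y => ‖f y‖ₑ) x).toReal)
      (ENNReal.ofReal ((Module.finrank ℝ E : ℝ) * p.toReal /
        ((Module.finrank ℝ E : ℝ) - α * p.toReal))) μ := by
  have hP0 : 0 < p.toReal := by linarith
  have hnP : 0 < (Module.finrank ℝ E : ℝ) - α * p.toReal := by linarith
  have hn0 : 0 < (Module.finrank ℝ E : ℝ) := lt_trans (mul_pos hα hP0) hαp
  have ha0 : 0 ≤ (Module.finrank ℝ E : ℝ) / ((Module.finrank ℝ E : ℝ) - α * p.toReal) :=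
    (div_pos hn0 hnP).le
  obtain ⟨C, hC, H⟩ := eWeakLpPow_rieszPotential_toReal_le μ (F := F) hp hα hαp
  refine ⟨?_, lt_of_le_of_lt (H f hf.1) (ENNReal.mul_lt_top hC
    (ENNReal.rpow_lt_top_of_nonneg ha0 hf.2.ne))⟩
  have hΦ : (fun y => (‖f y‖ₑ : ℝ≥0∞)) =ᵐ[μ] fun y => (‖hf.1.mk f y‖ₑ : ℝ≥0∞) :=
    hf.1.ae_eq_mk.mono fun y hy => by simp [hy]
  rw [rieszPotential_congr_ae μ α hΦ]
  exact (measurable_rieszPotential μ α hf.1.stronglyMeasurable_mk.enorm).ennreal_toReal.aestronglyMeasurable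

/-- **The Riesz potential of a weak-`L^p` function is finite almost everywhere** (`1 < p`,
`0 < α`, `αp < n`): `I_α‖f‖(x) < ∞` for `μ`-a.e. `x` — Stein's part (a) of the theorem of fractional
integration, for weak-`L^p` data. [cite: Stein1971, Ch. V §1.2 Theorem 1 (a)] -/
theorem rieszPotential_lt_top_ae {α : ℝ} {p : ℝ≥0∞} (hp : 1 < p.toReal) (hα : 0 < α)
    (hαp : α * p.toReal < (Module.finrank ℝ E : ℝ)) {f : E → F} (hf : MemWeakLp f p μ) :
    ∀ᵐ x ∂μ, rieszPotential μ α (fun y => ‖f y‖ₑ) x < ∞ := by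
  set n : ℝ := (Module.finrank ℝ E : ℝ) with hn
  set P : ℝ := p.toReal with hP
  have hP0 : 0 < P := by linarith
  have hnP : 0 < n - α * P := by linarith
  have hn0 : 0 < n := lt_trans (mul_pos hα hP0) hαp
  set q : ℝ := n * P / (n - α * P) with hq
  set a : ℝ := n / (n - α * P) with ha
  have hq0 : 0 < q := div_pos (mul_pos hn0 hP0) hnP
  have ha0 : 0 ≤ a := (div_pos hn0 hnP).le
  obtain ⟨C, hC, H⟩ := meas_lt_rieszPotential_le_of_eWeakLpPow μ (F := F) hp hα hαp
  set W : ℝ≥0∞ := eWeakLpPow f p μ with hW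
  set S : Set E := {x | rieszPotential μ α (fun y => ‖f y‖ₑ) x = ∞} with hS
  have key : ∀ t : ℝ, 0 < t → μ S ≤ C * W ^ a * ENNReal.ofReal (t ^ (-q)) := fun t ht =>
    (measure_mono (fun x hx => by
      rw [hS, mem_setOf_eq] at hx
      rw [mem_setOf_eq, hx]
      exact ENNReal.ofReal_lt_top)).trans (H f hf.1 t ht)
  have hK : C * W ^ a ≠ ∞ := ENNReal.mul_ne_top hC.ne (ENNReal.rpow_ne_top_of_nonneg ha0 hf.2.ne)
  have hlim : Tendsto (fun t : ℝ => C * W ^ a * ENNReal.ofReal (t ^ (-q))) atTop (𝓝 0) := by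
    have h1 : Tendsto (fun t : ℝ => ENNReal.ofReal (t ^ (-q))) atTop (𝓝 0) := by
      rw [← ENNReal.ofReal_zero]
      exact ENNReal.tendsto_ofReal (tendsto_rpow_neg_atTop hq0)
    have h2 := ENNReal.Tendsto.const_mul h1 (Or.inr hK)
    rw [mul_zero] at h2
    exact h2
  have hle : μ S ≤ 0 :=
    ge_of_tendsto hlim (Filter.eventually_atTop.2 ⟨1, fun t ht => key t (by linarith)⟩)
  rw [ae_iff]
  have hS' : {x | ¬ rieszPotential μ α (fun y => ‖f y‖ₑ) x < ∞} = S := by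
    ext x; simp [hS]
  rw [hS']
  exact le_antisymm hle bot_le

/-! ### The instance `ℝ³`, `α = 1` -/

/-- **Weak HLS on `ℝ³` at order `α = 1`**: for `1 < p < 3` and `q = 3p/(3 − p)` there is
`C < ∞` with `|{x ∈ ℝ³ : t < I₁‖f‖(x)}| ≤ C (sup_s s^p|{‖f‖ > s}|)^{3/(3−p)} t^{−q}` for every
a.e.-strongly measurable `f` and `t > 0`; `I₁Φ(x) = ∫ Φ(y)|x − y|⁻² dy` dominates the Biot–Savart and
Newton-gradient kernels (`|K(x−y)| ≤ c|x−y|⁻²`), so e.g. `p = 9/5 ↦ q = 9/2`: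
`‖K ∗ ω‖_{L^{9/2,∞}} ≲ ‖ω‖_{L^{9/5,∞}}`. [cite: Stein1971, Ch. V §1.2 Theorem 1 and §1.4 (Comment)] -/
theorem exists_weakHLS_one_R3 {p : ℝ≥0∞} (hp : 1 < p.toReal) (hp3 : p.toReal < 3) :
    ∃ C : ℝ≥0∞, C < ∞ ∧ ∀ (f : EuclideanSpace ℝ (Fin 3) → F), AEStronglyMeasurable f volume →
      ∀ t : ℝ, 0 < t →
        volume {x | ENNReal.ofReal t < rieszPotential volume 1 (fun y => ‖f y‖ₑ) x} ≤
          C * eWeakLpPow f p volume ^ (3 / (3 - p.toReal)) *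
            ENNReal.ofReal (t ^ (-(3 * p.toReal / (3 - p.toReal)))) := by
  have h3 : (Module.finrank ℝ (EuclideanSpace ℝ (Fin 3)) : ℝ) = 3 := by
    rw [finrank_euclideanSpace_fin]; norm_num
  obtain ⟨C, hC, H⟩ := meas_lt_rieszPotential_le_of_eWeakLpPow
    (volume : Measure (EuclideanSpace ℝ (Fin 3))) (F := F) (α := 1) (p := p) hp one_pos
    (by rw [h3, one_mul]; exact hp3)
  refine ⟨C, hC, fun f hf t ht => ?_⟩
  have h := H f hf t ht
  simp only [h3, one_mul] at h
  exact h

/-- **The endpoint Biot–Savart exponents `9/5 ↦ 9/2` on `ℝ³`**: `|{t < I₁‖f‖}| ≤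
C (sup_s s^{9/5}|{‖f‖ > s}|)^{5/2} t^{−9/2}`, i.e. `‖I₁|f|‖_{L^{9/2,∞}} ≲ ‖f‖_{L^{9/5,∞}}` (the
Lorentz–HLS step of critical steady Navier–Stokes Liouville theorems with `curl v ∈ L^{9/5,∞}`).
[cite: Stein1971, Ch. V §1.2 Theorem 1 and §1.4 (Comment)] -/
theorem exists_weakHLS_one_nineFifths :
    ∃ C : ℝ≥0∞, C < ∞ ∧ ∀ (f : EuclideanSpace ℝ (Fin 3) → F), AEStronglyMeasurable f volume →
      ∀ t : ℝ, 0 < t →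
        volume {x | ENNReal.ofReal t < rieszPotential volume 1 (fun y => ‖f y‖ₑ) x} ≤
          C * eWeakLpPow f ((9 : ℝ≥0∞) / 5) volume ^ ((5 : ℝ) / 2) *
            ENNReal.ofReal (t ^ (-((9 : ℝ) / 2))) := by
  have h95 : ((9 : ℝ≥0∞) / 5).toReal = 9 / 5 := by
    rw [ENNReal.toReal_div]; norm_num
  obtain ⟨C, hC, H⟩ := exists_weakHLS_one_R3 (F := F) (p := (9 : ℝ≥0∞) / 5)
    (by rw [h95]; norm_num) (by rw [h95]; norm_num)
  refine ⟨C, hC, fun f hf t ht => ?_⟩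
  have h := H f hf t ht
  have e1 : (3 : ℝ) / (3 - 9 / 5) = 5 / 2 := by norm_num
  have e2 : -((3 : ℝ) * (9 / 5) / (3 - 9 / 5)) = -(9 / 2) := by norm_num
  rw [h95, e1, e2] at h
  exact h

end Literature.Analysis.SingularIntegrals

end

-- WHAT THIS IS NOT: not a claim about NS regularity or blow-up; not a claim about any author beyond the typed locator.
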